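import Mathlib
import HarnessLib
import Literature.NumberTheory.GaloisRepresentations.GaloisRep
import Literature.NumberTheory.GaloisRepresentations.FramedRepTwist
import Literature.RepresentationTheory.Semisimple.Twist

/-!
# Twisting a framed Galois representation by a continuous character preserves irreducibility
(crux stmt-Langlands-15111, line Sketch) — helper file (`--supports`), odd-descent-up-to-twist sector

For a framed Galois representation `ρ : Γ_K →ₜ* GL_n(A)` over a topological field `A` and a
continuous character `χ : Γ_K →ₜ* Aˣ`, the representation on `Fin n → A` underlying the framed
twist `ρ ⊗ χ : g ↦ χ(g) · ρ(g)` (`FramedRep.twist`) is the twist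
`Representation.twist ρ.toRepresentation χ` of the underlying representation
(`toRepresentation_twist_eq`: as matrices `(χ g • ρ g) *ᵥ v = χ g • (ρ g *ᵥ v)`), and a
representation and all its twists have the same subrepresentations
(`Literature.RepresentationTheory.Semisimple.Representation.isIrreducible_twist_iff`).  Hence
`ρ ⊗ χ` is irreducible iff `ρ` is.

* `toRepresentation_twist_eq` — `(ρ.twist χ).toRepresentation = ρ.toRepresentation ⊗ χ`.
* `stub_isIrreducible_twist_iff` — `(ρ ⊗ χ).toGaloisRep.IsIrreducible ↔ ρ.toGaloisRep.IsIrreducible`.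

No definitions.
-/

noncomputable section

open Literature.NumberTheory.GaloisRepresentations

-- `Summit.Langlands.Langlands.…`: summit = sub-problem name (D-0017 nested layout), not a typo.
set_option linter.dupNamespace false

namespace Summit.Langlands.Langlands.Theorems.ArtinWeightRealisationLevel

-- adapted from Literature/NumberTheory/GaloisRepresentations/TwistedSumFiniteOrderGeneric.lean
-- (`FramedRep.toRepresentation_twist`), restated here to keep the import closure small.
/-- The representation underlying a framed twist `ρ ⊗ χ` is the twist of the underlying
representation by `χ` viewed as a `MonoidHom`: `(χ g • ρ g) *ᵥ v = χ g • (ρ g *ᵥ v)`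
(`Matrix.smul_mulVec`). [folklore] -/
theorem toRepresentation_twist_eq {G : Type*} [Group G] [TopologicalSpace G] {A : Type*} [Field A]
    [TopologicalSpace A] [IsTopologicalRing A] {n : ℕ} (ρ : FramedRep G A n) (χ : G →ₜ* Aˣ) :
    (FramedRep.twist ρ χ).toRepresentation =
      Literature.RepresentationTheory.Semisimple.Representation.twist ρ.toRepresentation
        (χ : G →* Aˣ) := by
  refine MonoidHom.ext fun g => LinearMap.ext fun v => ?_
  rw [FramedRep.toRepresentation_apply_apply, FramedRep.coe_twist_apply,
    Literature.RepresentationTheory.Semisimple.Representation.twist_apply_apply,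
    FramedRep.toRepresentation_apply_apply, Matrix.smul_mulVec]
  rfl

/-- **Twisting by a continuous character preserves irreducibility.**  For a framed Galois
representation `ρ : Γ_K →ₜ* GL_n(A)` and a continuous character `χ : Γ_K →ₜ* Aˣ`, the Galois
representation underlying `ρ ⊗ χ` is irreducible iff the one underlying `ρ` is: the underlying
representation of the twist is the twist of the underlying representation
(`toRepresentation_twist_eq`), and twisting does not change the lattice of subrepresentations
(`Representation.isIrreducible_twist_iff`). [folklore] -/
theorem stub_isIrreducible_twist_iff : ∀ (K : Type) [Field K] (A : Type) [Field A] [TopologicalSpace A] [IsTopologicalRing A] (n : ℕ) (ρ : Literature.NumberTheory.GaloisRepresentations.FramedGaloisRep K A n) (χ : Field.absoluteGaloisGroup K →ₜ* Aˣ), (Literature.NumberTheory.GaloisRepresentations.FramedGaloisRep.toGaloisRep (Literature.NumberTheory.GaloisRepresentations.FramedRep.twist ρ χ)).IsIrreducible ↔ ρ.toGaloisRep.IsIrreducible := by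
  intro K _ A _ _ _ n ρ χ
  change (FramedRep.twist ρ χ).toRepresentation.IsIrreducible ↔ ρ.toRepresentation.IsIrreducible
  rw [toRepresentation_twist_eq]
  exact Literature.RepresentationTheory.Semisimple.Representation.isIrreducible_twist_iff _ _

end Summit.Langlands.Langlands.Theorems.ArtinWeightRealisationLevel

end
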